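import Literature.MathematicalPhysics.QuantumFieldTheory.Balaban1983to89.Beta.RemainderHasMajH1kTowerPlaquette
import Literature.MathematicalPhysics.QuantumFieldTheory.Balaban1983to89.Beta.RemainderTowerDisplayIrrel
import Literature.MathematicalPhysics.QuantumFieldTheory.Balaban1983to89.Beta.RemainderDecay190Dictionary

/-!
# T. Bałaban, *Renormalization group approach to lattice gauge field theories. I*, Commun. Math. Phys. **109** (1987) 249–301 [Balaban1987RG1] p. 282 and
# (4.35) p. 290 ⟵ [Balaban1985Variational] (190) p. 308, (129) p. 297, [Balaban1985BackgroundPropagators] (3.126) p. 420, (3.133) p. 422 and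
# [Balaban1984PropagatorsII] (1.103) p. 36, Lemma 2.1 (2.61) p. 234: **THE (190)-SOCKET `Data190` OF ROW (D4) INHABITED ON THE BOND-FIELD CARRIERS OF THE
# TOWER AT ZERO BACKGROUND — B-data = coarse bond fields, configurations = fine bond fields, `(δ∕δB)𝓗(0) = H₁,k(1)` of (3.126) ∕ (1.103), blocks = the unit
# lattice sites, NO displayed analytic letter** (memo `FLAT-LETTERS-LOCATED.md` §9 R7 executed on «Y12a»; this lineage gen 115, «Y19»)

CITATION HEADER (lean-in-tree rule 2026-08-18).  Audit cell `pub-balaban`, BINDER row (D4) (`RemainderConst` leaves for Bałaban's split), OWNER lineage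
`b2b-balaban-beta-an4`, gen 115.  Sources: [Balaban1987RG1] ([I]; held `paper:balaban1987-cmp109-rg-i-small-field`, PDF page = journal page − 248): (4.4)
p. 281, p. 282 (*"The norm in (4.4) of the expression ⟨(δ^{n(p)}/δB^{n(p)})𝐇_j(□₀, 0), ⊗_{i∈N(p)}B_i⟩ can be estimated by B₃∏_{i∈N(p)}∣B_i∣, and if one of the
functions B_i is localized outside the domain X, then we have the additional exponential factor exp(−δ₀dist^{(ξ)}(X, supp B_i))"*), (4.35) p. 290;
[Balaban1985Variational] ([15]; `paper:balaban1985-cmp102-variational-background`, journal page = PDF page + 276): (129)–(131) pp. 297–298 (`H₀ = GQ*(QGQ*)⁻¹`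
and (130) *"satisfies the bound (3.133) [5]"*), (182) p. 307, (190) p. 308; [Balaban1985BackgroundPropagators] ([5]; `paper:balaban1985-cmp99-background-propagators`,
journal page = PDF page + 388): (3.126) p. 420, (3.132)–(3.133) p. 422, (3.134) p. 422 (at `U = 1` the current `J` vanishes, so `Δ⁽²⁾(1) = 0`), Thm 3.11
p. 416, (3.35)–(3.37) p. 396; [Balaban1984PropagatorsII] ([3]): (1.103) p. 36, (2.46) p. 231, (2.51)–(2.52) p. 232, Lemma 2.1 (2.61) p. 234;
[Balaban1985Averaging] ([4]) Prop. 2 (52)–(54) p. 26.  Loci as printed in the headers of the tree files consumed; nothing of print is asserted here.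

WHY THIS FILE («Y19»).  The (190)-socket of row (D4) — `Beta.RemainderDecay190.Data190 d M N Wn q`, the [15]∕[3]-side data replacing the located p. 282 leaf
`hh` of the k-uniform remainder chain (`ChainT190` ∕ `ChainTFac190 ⟶ RemainderConst`) — is GENERIC in its carriers but was so far INHABITED only on the scalar
SITE model of generations 91–96 (`Beta.RemainderDecay190Periodised.exists_data190_of_entry_cubes_supNorm` and descendants), whose `(δ∕δB)𝓗` is an abstract
kernel family.  Since gen 111 the tree holds NODE D at the origin ON THE NE9 TOWER for [3] (1.103)'s ∕ [5] (3.126)'s `H₁,k(U) = G₁,kQ_k†(Q_kG₁,kQ_k†)⁻¹`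
(`B9Eq326OperatorTower.H1k`: coarse bond fields `Bond d m → W` ⟶ fine bond fields `Bond d (towerP L m (k+1)) → W`), first entry of (190) in the sup currency,
`∃`-first, on print's class with every model letter DERIVED («Y12a» §3); at `U = 1` [15] (182)'s derivative at the origin IS `H₀ = H₁,k(1)` («Y15»; `Δ⁽²⁾(1) = 0`).
THIS FILE is the plumbing memo §9 R7 asked for — `Data190` inhabited ON THESE CARRIERS, and the zero-background instance with Bałaban's flat operator, letter-free:
* §1 **`exists_ineq190_H1k_flat`** — the (190) LETTER OF `H₁,k(1)`, `∃ (δ⋆, C⋆)` FIRST (functions of the structure data `d, L, 𝔸, φ, τ, a, a′, ρ_w, A_Q`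
  only): for every height `k` on the diagonal, weights, EVERY period `m`, every block-torus geometry record and every `(C, δ₁₅)` with `δ₁₅ ≤ δ⋆`, `C⋆ ≤ C`:
  `∃ (αU, hα1, hαL, hU1, hreg, hpos)` DERIVED with `Ineq190 S^{coarse}_m S^{fine}_m (H₁,k(1))ᵉ↾ℝ C δ₁₅` — «Y12a» §3 at `U := 1`, `α := 0`, rates
  `ρ = σ := min(δ, r₁)∕(2d)`, `δ⋆ := 8ρ`, `C⋆ := B·M†·e·K_d(1)·e^{δ}·A′·c₀(1,ρ)^d`, then `HasMaj.mono`.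
* §2 dictionary lemmas on the bond carriers ([I] p. 282 ∕ (4.4) in the vocabulary of (190)): `supNorm_single_le`, `mem_of_supNorm_single_ne_zero` (the sup
  size of a one-bond source `δ_b·w` is `≤ ‖w‖` and locates the block of `b`), `finOfVal_natCast` (ê ∘ cast = id), `distD_geomT_le_pl1_of_mem` (the p. 282
  distance of a unit-lattice site to `X̄` is at most its periodic `ℓ¹` distance to ANY unit-lattice site of a cube of `X̄`).
* §3 **`exists_data190_tower_of_ineq190`** — THE SOCKET ON THESE CARRIERS, GENERIC IN THE DERIVATIVE: ANY family of `ℝ`-linear `T n :` coarse bond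
  fields `Bond d (N n·M)^d → W` ⟶ fine bond fields `Bond d (towerP L (N n·M)^d (k+1)) → W` with the (190) letter between the sup sizes over the unit-lattice
  blocks (`B11SupSize190.supSize`; the carriers of «Y5c»∕«Y12a»∕«Y15»∕«Y18» VERBATIM) on every volume, plus NUMERICS on `q`, gives `∃ D : Data190 d M N (fine
  bond fields) q`: B-data := coarse bond fields, `gn n :=` the block torus `UT (N n·M)^d` (blocks = unit-lattice SITES, `d₁`), `dHn := T`, `blkn n X̄ :=`
  ê''(unit-lattice sites of the cubes of `X̄`), (4.4)-space := ALL fine bond fields (sup norm), `ιn n X̄ :=` restriction to the fine bonds above `X̄`,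
  `un n x := δ_{(ê x, μ₀)}·w₀`, and the (4.35) RULE `D.hn n X̄ x = (b ↦ [site below b ∈ X̄] ? (T n (δ_{(ê x, μ₀)}·w₀))(b) : 0)` (`hrow` ∕ `hdist` by
  `Beta.RemainderRowSum.hrow_torusGeom` ∕ `Beta.RemainderDecay190SectGTorus.hdist_torusGeom`, the rest by §2; conversion factor `θ ≤ 1` — blocks ARE
  unit-lattice sites, `dist^{(ξ)}` and `d(y,y′)` are one periodic `ℓ¹` distance, `Beta.RemainderDecay190Dictionary.tdist1_finOfVal_eq_pl1`) — the socket
  «Y18»'s `H₀ + G̃Δ⁽²⁾H₀` in a background field plugs into next; **`exists_data190_tower_flat`** = §3-generic ∘ §1: `dHn n := (H₁,k(1))ᵉ↾ℝ` at a display ∕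
  witness chosen per volume, the rule stated for EVERY admissible display ∕ witness the consumer may hold («Y12c» `H1k_display_irrel`).

HONEST SCOPE.  [folklore] plumbing: one application of «Y12a» §3 and bookkeeping; NO estimate of [5], [15], [3], [4] or [I] is proved here.  The zero-background
MODEL instance of NODE D on the one-domain tower `Ω_k = T_η` (value line of (190) only — every local size `boutn n i` is the value sup size; the `∇` ∕ Hölder ∕
Laplacian lines of (190) ∕ [I] (4.4) are NOT fed), ONE unit source per unit-lattice site (direction `μ₀`, value `w₀`; print's `u(x)` ranges over all bonds and
Lie-algebra directions — the index type `TPt d (N n·M)` of `Data190.un` is the site model's).  NOT Bałaban's instance in a background field (there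
`(δ∕δB)𝓗(0) = H₀ + G̃Δ⁽²⁾H₀`, «Y18»), NOT the multi-level `{Ω_j}` case, NOT (189), NOT the other leaves of `PolLeavesT190`.  Row (D4) class UNCHANGED (instance
0∕1; critical-path width 0 = NODE O; D4 DISCHARGE NO DATE); NOT B12 Thm 2, NOT BetaPertH, NOT continuum, NOT Clay.  HONEST DEPENDENCY (cell line): continuum YM
on T⁴ ⇐ BetaPertH ∧ nine spine estimates (0/9 proved); BetaPertH ⇐ (D1) ∧ (D4) ∧ CAP+tail; G-an2-4 gates asym, D1 and NE2/3/4.  NEW file; nothing modified;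
0 `def`; standard axioms; no `sorry`; default heartbeats.  Net new unproved facts: 0.
-/

noncomputable section

open scoped BigOperators InnerProductSpace ComplexConjugate

namespace Literature.MathematicalPhysics.QuantumFieldTheory.Balaban1983to89.Beta.RemainderData190TowerFlat

open B11SectG B11SupSize190 open B4Sect5Torus (TSite) open B4Sect5Proof (latticeConst latticeConst_nonneg) open B5TorusCover (UT) open B6RandomWalk (c0_nonneg)
open B9Thm34Ext (toB6) open B9Thm37GlueTorus (torusGeom tdist1 tdist1_nonneg) open B9SectCLatticeCarrier (Bond bpos unshift) open B9Eq311L2Pairing (WL2)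
open B9Eq319QprimeTorus (blockCoord) open B9Eq315QTower (towerP UlevOf) open B9Eq315QTorus (perCfg cornerSite)
open B9Eq316TowerFlatIsOneStep (siteCast towerP_eq_fineP_pow) open B7Prop1Explicit (U1 Wcx boxVec) open B7Prop2Explicit (c2' unitaryUnits)
open B9Eq310DeltaPrime (plaqHolU plaqHolU_one) open B11Eq103H1Complex (BondL2K) open B9Eq326OperatorTower (laplaceAk H1k) open TreeLengthTorus (TPt TDom tsys)
open B12Decay510Torus (pl1 pl1_nonneg pl1_sub_comm tcubeOf distCT_le nearT_le geomT geomT_distD) open B12Decay510FromB11 (NormDominated UnitFieldsLocalised)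
open Beta.RemainderDecay190 (Data190 Consts190) open Beta.RemainderRowSum (hrow_torusGeom) open Beta.RemainderDecay190SectGTorus (hdist_torusGeom)
open Beta.RemainderDecay190Dictionary (tdist1_finOfVal_eq_pl1) open Beta.RemainderHasMajH1kTowerPlaquette (exists_hasMaj_H1k_tower_plaquette)
open Beta.RemainderTowerDisplayIrrel (H1k_display_irrel)

/-! ## §1 The (190) letter of `H₁,k(1)` on the tower, `∃ (δ⋆, C⋆)` first, an admissible display ∕ witness derived -/

section Flat

variable {d : ℕ} (hd : 1 ≤ d) (L : ℕ) [NeZero L] (hL : 1 ≤ L) (hL3 : 3 ≤ L)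
  {𝔸 : Type*} [CStarAlgebra 𝔸] [Nontrivial 𝔸]
  {W : Type} [NormedAddCommGroup W] [InnerProductSpace ℂ W] [FiniteDimensional ℂ W] (φ : W ≃ₗ[ℂ] 𝔸)
  {Mφ Mφ' : ℝ} (hMφ : 0 ≤ Mφ) (hMφ' : 0 ≤ Mφ') (hφ : ∀ w, ‖φ w‖ ≤ Mφ * ‖w‖) (hφ' : ∀ X, ‖φ.symm X‖ ≤ Mφ' * ‖X‖)
  {a : ℝ} (ha : 0 < a) {a' : ℝ} (ha' : 0 < a')
  (τ : 𝔸 →ₗ[ℂ] ℂ) {Cτ : ℝ} (hτ : ∀ X, ‖τ X‖ ≤ Cτ * ‖X‖) (hCτ : 0 ≤ Cτ) {Mτ : ℝ} (hτm : ∀ X Y : 𝔸, ‖τ (X * Y)‖ ≤ Mτ * ‖X‖ * ‖Y‖) (hMτ : 0 ≤ Mτ)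
  {ρw : ℝ} (hρw : 0 ≤ ρw)
  (hτ₁ : ∀ X : 𝔸, τ (star X) = conj (τ X)) (hτ₂ : ∀ X Y : 𝔸, τ (X * Y) = τ (Y * X)) (hφτ : ∀ X Y : 𝔸, ⟪φ.symm X, φ.symm Y⟫_ℂ = τ (star X * Y))
  (AQ : ℝ) (hAQ16 : 16 * ((d : ℝ) + 1) * ((d : ℝ) + 4) * c2' d L ≤ AQ)

include hd hL hL3 hMφ hMφ' hφ hφ' ha ha' hτ hCτ hτm hMτ hρw hτ₁ hτ₂ hφτ hAQ16 in
/-- **THE (190) LETTER OF `H₁,k(1)` ON THE TOWER, `∃ (δ⋆, C⋆)` FIRST** («Y12a» `exists_hasMaj_H1k_tower_plaquette` at the flat configuration `U := 1`: the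
three windows with `α := 0` — `‖1 − 1‖ = 0`, `U(∂p) = 1` (`plaqHolU_one`) —, `1 ∈ unitaryUnits`, rates `ρ = σ := min(δ, r₁)∕(2d)`; then `HasMaj.mono` from
`C⋆·e^{−ρ·d₁}` to `C·e^{−(δ₁₅∕8)·d₁}`): `δ⋆ > 0`, `C⋆ ≥ 0` depend on the structure data only; for every height `k` (diagonal, weights), period `m`, geometry
record and `(C, δ₁₅)` with `δ₁₅ ≤ δ⋆`, `C⋆ ≤ C` THERE ARE an admissible regularity display `(αU, hα1, hαL, hU1, hreg)` and a positivity witness `hpos` of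
`Δ_{a,k}(1)` ([5] Thm 3.11) with `Ineq190 S^{coarse}_m S^{fine}_m (H₁,k(1))ᵉ↾ℝ C δ₁₅` — the first entry of [15] (190) for `(δ∕δB)𝓗(0) = H₀ = H₁,k(1)` ([15]
(129)–(130) ∕ [5] (3.133) ∕ [3] (1.103)).  The operator does not depend on the display nor on the witness («Y12c» `H1k_display_irrel`).
[cite: Balaban1985Variational, (129)–(130) p.297, (190) p.308] [cite: Balaban1985BackgroundPropagators, (3.126) p.420, (3.133) p.422, (3.134) p.422, Thm 3.11 p.416,
(3.35)–(3.37) p.396] [cite: Balaban1984PropagatorsII, (1.103) p.36, (2.51)–(2.52) p.232, Lemma 2.1 (2.61) p.234] [cite: Balaban1985Averaging, Prop. 2 (52)–(54) p.26] -/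
theorem exists_ineq190_H1k_flat :
    ∃ δs Cs : ℝ, 0 < δs ∧ 0 ≤ Cs ∧
      ∀ (k : ℕ) (η : ℝ) (_hηL : η * (L : ℝ) ^ (k + 1) = 1) (c₀ c₁ : ℝ) [Fact (0 < c₀)] [Fact (0 < c₁)]
        (_hw : c₀ * ((L : ℝ) ^ (k + 1)) ^ d = c₁) (_hρ : |η| ^ d / c₀ ≤ ρw) (m : Fin d → ℕ) [∀ i, NeZero (m i)] (_hm : ∀ i, 1 ≤ m i)
        (η₀ L₀ M₀ R : ℝ) (H : Prop) (C δ15 : ℝ) (_hδ : δ15 ≤ δs) (_hC : Cs ≤ C),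
        ∃ (αU : ℕ → ℝ) (hα1 : ∀ j, αU j ≤ 1 / 64) (hαL : ∀ j, 50 * (d + 1) * αU j * (L : ℝ) ^ d ≤ 1 / 2)
          (hU1 : ∀ (j : ℕ) (x : B7Prop1Explicit.Site d) (κ : Fin d),
            perCfg (towerP L m (j + 1)) (UlevOf L m (k + 1) (fun _ => (1 : 𝔸ˣ)) j) x κ ∈ U1 𝔸)
          (hreg : ∀ (j : ℕ) (y : TSite d (towerP L m j)) (κ : Fin d) (ρ' : Fin d → Fin L),
            ‖((Wcx L (perCfg (towerP L m (j + 1)) (UlevOf L m (k + 1) (fun _ => (1 : 𝔸ˣ)) j)) (cornerSite L y) κ (boxVec L ρ') : 𝔸ˣ) : 𝔸) - 1‖ ≤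
              αU j)
          (hpos : ∀ x : BondL2K ℂ d (towerP L m (k + 1)) c₀ W, x ≠ 0 →
            0 < RCLike.re ⟪x, laplaceAk L m k φ η (fun _ => (1 : 𝔸ˣ)) hL αU hα1 hU1 hreg τ (c₀ := c₀) (c₁ := c₁) a x⟫_ℂ),
        Ineq190
          (supSize (toB6 (torusGeom m η₀ L₀ M₀) R H)
            (fun y => Finset.univ.filter fun c : Bond d m => bpos c = UT.toSite m y)
            (fun c => UT.ofSite m (bpos c)) : BlockNorm (toB6 (torusGeom m η₀ L₀ M₀) R H) (Bond d m → W))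
          (supSize (toB6 (torusGeom m η₀ L₀ M₀) R H)
            (fun y => Finset.univ.filter fun b : Bond d (towerP L m (k + 1)) =>
              blockCoord (L ^ (k + 1)) m (siteCast (towerP_eq_fineP_pow L m (k + 1)) (bpos b)) = UT.toSite m y)
            (fun b => UT.ofSite m (blockCoord (L ^ (k + 1)) m (siteCast (towerP_eq_fineP_pow L m (k + 1)) (bpos b)))) :
              BlockNorm (toB6 (torusGeom m η₀ L₀ M₀) R H) (Bond d (towerP L m (k + 1)) → W))
          (((WL2.linearEquiv ℂ ℂ (fun _ : Bond d (towerP L m (k + 1)) => c₀) :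
                  BondL2K ℂ d (towerP L m (k + 1)) c₀ W ≃ₗ[ℂ] (Bond d (towerP L m (k + 1)) → W)).toLinearMap ∘ₗ
              H1k L m k φ η (fun _ => (1 : 𝔸ˣ)) hL αU hα1 hU1 hreg τ (c₀ := c₀) (c₁ := c₁) hαL hpos ∘ₗ
              (WL2.linearEquiv ℂ ℂ (fun _ : Bond d m => c₁) : BondL2K ℂ d m c₁ W ≃ₗ[ℂ] (Bond d m → W)).symm.toLinearMap).restrictScalars ℝ)
          C δ15 := by
  obtain ⟨αs, B, δ, A', r₁, hαs, hB, hδ, hA', hr₁, HY⟩ :=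
    exists_hasMaj_H1k_tower_plaquette hd L hL hL3 φ hMφ hMφ' hφ hφ' ha ha' τ hτ hCτ hτm hMτ hρw hτ₁ hτ₂ hφτ AQ hAQ16
  have hd0 : (0 : ℝ) < d := by exact_mod_cast hd
  -- the common rate `ρ = σ := min(δ, r₁)∕(2d)`
  obtain ⟨ρ, hρ0, hρdef⟩ : ∃ ρ : ℝ, 0 < ρ ∧ ρ = min δ r₁ / (2 * d) := ⟨_, by positivity, rfl⟩
  have hρI : ρ ≤ r₁ / d := by
    rw [hρdef, div_le_div_iff₀ (by positivity) hd0]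
    nlinarith [min_le_right δ r₁, hr₁.le, hd0]
  have hρ₁ : ρ + ρ ≤ δ / d := by
    rw [hρdef, ← two_mul, le_div_iff₀ hd0]
    have e : 2 * (min δ r₁ / (2 * d)) * d = min δ r₁ := by field_simp
    rw [e]; exact min_le_left δ r₁
  -- the constant of «Y12a» at `σ = ρ`
  obtain ⟨Cs, hCsdef⟩ : ∃ Cs : ℝ, Cs = B * ((Mφ' * Real.exp (100 * d * (d + 1) * (L : ℝ) ^ d * AQ) * Mφ * ((2 * d : ℕ) : ℝ)) * Real.exp 1 *
      latticeConst d 1) * Real.exp δ * A' * (B6.c0 1 ρ ^ d) := ⟨_, rfl⟩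
  have hCs : 0 ≤ Cs := by
    rw [hCsdef]
    have h1 : 0 ≤ latticeConst d 1 := latticeConst_nonneg d zero_le_one
    have h2 : 0 ≤ B6.c0 1 ρ ^ d := pow_nonneg (c0_nonneg _ _) _
    positivity
  refine ⟨8 * ρ, Cs, by positivity, hCs, ?_⟩
  intro k η hηL c₀ c₁ _ _ hw hρw' m _ hm η₀ L₀ M₀ R H C δ15 hδ hC
  -- the flat background: unitary, and print's three windows with `α = 0`
  have hUu : ∀ b : Bond d (towerP L m (k + 1)), ((fun _ => (1 : 𝔸ˣ)) b) ∈ unitaryUnits 𝔸 := fun _ => Subgroup.one_mem _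
  have hUη : ∀ b : Bond d (towerP L m (k + 1)), ‖(((fun _ => (1 : 𝔸ˣ)) b : 𝔸ˣ) : 𝔸) - 1‖ ≤ 0 * η := fun _ => by simp
  have hpl : ∀ p : B9SectCLatticeCarrier.Plaq d (towerP L m (k + 1)), ‖(plaqHolU (fun _ => (1 : 𝔸ˣ)) p : 𝔸) - 1‖ ≤ 0 * η ^ 2 :=
    fun p => by rw [plaqHolU_one]; simp
  have hUgrad : ∀ (x : TSite d (towerP L m (k + 1))) (μ : Fin d),
      ‖(((fun _ => (1 : 𝔸ˣ)) (x, μ) : 𝔸ˣ) : 𝔸) - ((fun _ => (1 : 𝔸ˣ)) (unshift μ x, μ) : 𝔸ˣ)‖ ≤ 0 * η ^ 2 := fun _ _ => by simp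
  obtain ⟨αU, hα1, hαL, hU1, hreg, hpos, hMaj⟩ := HY k η hηL c₀ c₁ hw hρw' m hm (fun _ => 1) hUu 0 le_rfl hαs.le hUη hpl hUgrad
    η₀ L₀ M₀ R H ρ ρ hρ0 hρ0.le hρI hρ₁
  refine ⟨αU, hα1, hαL, hU1, hreg, hpos, ?_⟩
  -- `C⋆·e^{−ρ d₁} ≤ C·e^{−(δ₁₅∕8) d₁}`
  refine hMaj.mono fun y v => ?_
  have hdist : 0 ≤ (toB6 (torusGeom m η₀ L₀ M₀) R H).dist y v := tdist1_nonneg y v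
  have hδ8 : δ15 / 8 ≤ ρ := by linarith
  rw [← hCsdef]
  exact mul_le_mul hC (Real.exp_le_exp.mpr (by nlinarith)) (Real.exp_pos _).le (hCs.trans hC)

end Flat

/-! ## §2 Dictionary lemmas on the bond carriers ([I] p. 282 ∕ (4.4) in the vocabulary of (190)) -/

section Dictionary

variable {X E : Type} [DecidableEq X] [NormedAddCommGroup E]

/-- **The size of a one-bond source**: over any finite point set, `sup ‖(δ_b·w)(·)‖ ≤ ‖w‖` — [I] p. 282's *"∏∣B_i∣"* for the unit sources of (4.35) in
the sup sizes of (190). [cite: Balaban1987RG1, p.282; Balaban1985Variational, (190) p.308] -/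
theorem supNorm_single_le (s : Finset X) (b : X) (w : E) : supNorm s (Pi.single b w : X → E) ≤ ‖w‖ :=
  supNorm_le (norm_nonneg w) fun c _ => by
    by_cases h : c = b
    · subst h; rw [Pi.single_eq_same]
    · rw [Pi.single_eq_of_ne h, norm_zero]; exact norm_nonneg w

/-- **The size of a one-bond source locates its bond**: if `sup_{s} ‖(δ_b·w)(·)‖ ≠ 0` then `b ∈ s` — [I] p. 282's *"supp B_i"* read in the blocks of (190).
[cite: Balaban1987RG1, p.282; Balaban1985Variational, (190) p.308] -/
theorem mem_of_supNorm_single_ne_zero {s : Finset X} {b : X} {w : E} (h : supNorm s (Pi.single b w : X → E) ≠ 0) : b ∈ s := by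
  by_contra hb
  refine h (le_antisymm (supNorm_le le_rfl fun c hc => ?_) (supNorm_nonneg _ _))
  rw [Pi.single_eq_of_ne (ne_of_mem_of_not_mem hc hb), norm_zero]

variable {d s : ℕ} [NeZero s]

/-- The cast `Π_i Fin s → (ℤ∕s)^d`, `y ↦ (i ↦ (y i : ℤ∕s))`, followed by `ê`, is the identity. [folklore] [cite: Balaban1984PropagatorsII, (2.46) p.231] -/
theorem finOfVal_natCast (y : TSite d (fun _ : Fin d => s)) :
    (fun i => (⟨(((y i : ℕ) : ZMod s)).val, ZMod.val_lt (((y i : ℕ) : ZMod s))⟩ : Fin s)) = y := by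
  funext i
  apply Fin.ext
  simp only [ZMod.val_natCast, Nat.mod_eq_of_lt (y i).isLt]

variable {N M : ℕ} [NeZero N] [NeZero M]

/-- **The p. 282 distance of a unit-lattice site to a localization domain is at most its periodic `ℓ¹` distance to ANY unit-lattice site of a cube of the
domain**: `dist(x, X̄) ≤ ‖x − p‖` whenever the cube of `p` belongs to `X̄` (`dist(x, X̄)` = the distance to the nearest cube, `B12Decay510Torus.nearT_le`, and
the distance to the cube of `p` is at most `‖x − p‖`, `distCT_le`). [cite: Balaban1987RG1, p.282 and §0 p.257] -/
theorem distD_geomT_le_pl1_of_mem (x p : TPt d (N * M)) (X : TDom d N) (hp : tcubeOf N M p ∈ X.1) :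
    (geomT d N M).distD x X ≤ pl1 (x - p) := by
  rw [geomT_distD]
  exact (nearT_le (M := M) x X hp).trans (distCT_le rfl)

end Dictionary

/-! ## §3 The (190)-socket `Data190` on the bond-field carriers of the tower: GENERIC in the derivative family, then at zero background -/

section Socket

variable {d : ℕ} (L : ℕ) {W : Type} [NormedAddCommGroup W] [NormedSpace ℂ W]

/-- **THE (190)-SOCKET ON THE BOND-FIELD CARRIERS OF THE TOWER FROM ONE (190) LETTER PER VOLUME** (carrier-generic join certificate; the twin, for
Bałaban's carriers, of `Beta.RemainderDecay190Periodised.exists_data190_of_entry_cubes_supNorm` on the scalar site model) — see the module docstring §3: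
ANY family `T n` of `ℝ`-linear maps coarse bond fields ⟶ fine bond fields with `Ineq190 S^{coarse}_n S^{fine}_n (T n) q.Cst q.δ15` on every volume, and
numerics on `q`, give `∃ D : Data190 d M N (fun n => Bond d (towerP L (N n·M)^d (k+1)) → W) q` with `dHn := T` and the (4.35) computation rule
`D.hn n X̄ x = (b ↦ [unit-lattice site below b ∈ a cube of X̄] ? (T n (δ_{(ê x, μ₀)}·w₀))(b) : 0)`.  Fields: `h190 := hT`; `hdist` ∕ `hrow` := `hdist_torusGeom` ∕
`hrow_torusGeom`; `hκB` (`κ = 1`); `hdom`: a fine bond above `X̄` lies in the box of the unit-lattice site below it, which meets `X̄` (`norm_apply_le_loc`,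
`finOfVal_natCast`); `hm := supNorm_single_le`; `hD`: `mem_of_supNorm_single_ne_zero` + `distD_geomT_le_pl1_of_mem` + `tdist1_finOfVal_eq_pl1` (`θ ≤ 1`).
[cite: Balaban1987RG1, (4.4) p.281, p.282, (4.35) p.290] [cite: Balaban1985Variational, (190) p.308]
[cite: Balaban1984PropagatorsII, (2.46) p.231, (2.51)–(2.52) p.232, Lemma 2.1 (2.61) p.234] -/
theorem exists_data190_tower_of_ineq190 (k M : ℕ) [NeZero M] (N : ℕ → ℕ) [∀ n, NeZero (N n)] (I : Type) (i₀ : I)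
    (η₀ L₀ M₀ R : ℕ → ℝ) (H : ℕ → Prop) (μ₀ : Fin d) (w₀ : W) (q : Consts190) {δr : ℝ}
    (T : (n : ℕ) → (Bond d (fun _ : Fin d => N n * M) → W) →ₗ[ℝ] (Bond d (towerP L (fun _ : Fin d => N n * M) (k + 1)) → W))
    (hT : ∀ n, Ineq190
      (supSize (toB6 (torusGeom (fun _ : Fin d => N n * M) (η₀ n) (L₀ n) (M₀ n)) (R n) (H n))
        (fun y => Finset.univ.filter fun c : Bond d (fun _ : Fin d => N n * M) => bpos c = UT.toSite (fun _ : Fin d => N n * M) y)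
        (fun c => UT.ofSite (fun _ : Fin d => N n * M) (bpos c)) :
          BlockNorm (toB6 (torusGeom (fun _ : Fin d => N n * M) (η₀ n) (L₀ n) (M₀ n)) (R n) (H n)) (Bond d (fun _ : Fin d => N n * M) → W))
      (supSize (toB6 (torusGeom (fun _ : Fin d => N n * M) (η₀ n) (L₀ n) (M₀ n)) (R n) (H n))
        (fun y => Finset.univ.filter fun b : Bond d (towerP L (fun _ : Fin d => N n * M) (k + 1)) =>
          blockCoord (L ^ (k + 1)) (fun _ : Fin d => N n * M)
            (siteCast (towerP_eq_fineP_pow L (fun _ : Fin d => N n * M) (k + 1)) (bpos b)) = UT.toSite (fun _ : Fin d => N n * M) y)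
        (fun b => UT.ofSite (fun _ : Fin d => N n * M) (blockCoord (L ^ (k + 1)) (fun _ : Fin d => N n * M)
          (siteCast (towerP_eq_fineP_pow L (fun _ : Fin d => N n * M) (k + 1)) (bpos b)))) :
          BlockNorm (toB6 (torusGeom (fun _ : Fin d => N n * M) (η₀ n) (L₀ n) (M₀ n)) (R n) (H n))
            (Bond d (towerP L (fun _ : Fin d => N n * M) (k + 1)) → W))
      (T n) q.Cst q.δ15)
    (hδr : 0 < δr) (hσ₀ : 0 < q.σ) (hcR : B6.c0 δr (q.σ / δr) ^ d ≤ q.cR) (hκB : 1 ≤ q.κB) (hm : ‖w₀‖ ≤ q.m) (hθ1 : q.θ ≤ 1) :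
    ∃ D : Data190 d M N (fun n => Bond d (towerP L (fun _ : Fin d => N n * M) (k + 1)) → W) q,
      ∀ (n : ℕ) (X : TDom d (N n)) (x : TPt d (N n * M)),
        D.hn n X x = fun b : Bond d (towerP L (fun _ : Fin d => N n * M) (k + 1)) =>
          if tcubeOf (N n) M (fun i => ((blockCoord (L ^ (k + 1)) (fun _ : Fin d => N n * M)
                (siteCast (towerP_eq_fineP_pow L (fun _ : Fin d => N n * M) (k + 1)) (bpos b)) i : ℕ) : ZMod (N n * M))) ∈ X.1 then
            T n (Pi.single ((fun i => (⟨(x i).val, ZMod.val_lt (x i)⟩ : Fin (N n * M))), μ₀) w₀) b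
          else 0 := by
  refine ⟨{ I := I
            gn := fun n => toB6 (torusGeom (fun _ : Fin d => N n * M) (η₀ n) (L₀ n) (M₀ n)) (R n) (H n)
            FBn := fun n => Bond d (fun _ : Fin d => N n * M) → W
            FAn := fun n => Bond d (towerP L (fun _ : Fin d => N n * M) (k + 1)) → W
            bBn := fun n => supSize (toB6 (torusGeom (fun _ : Fin d => N n * M) (η₀ n) (L₀ n) (M₀ n)) (R n) (H n))
              (fun y => Finset.univ.filter fun c : Bond d (fun _ : Fin d => N n * M) => bpos c = UT.toSite (fun _ : Fin d => N n * M) y)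
              (fun c => UT.ofSite (fun _ : Fin d => N n * M) (bpos c))
            boutn := fun n _ => supSize (toB6 (torusGeom (fun _ : Fin d => N n * M) (η₀ n) (L₀ n) (M₀ n)) (R n) (H n))
              (fun y => Finset.univ.filter fun b : Bond d (towerP L (fun _ : Fin d => N n * M) (k + 1)) =>
                blockCoord (L ^ (k + 1)) (fun _ : Fin d => N n * M)
                  (siteCast (towerP_eq_fineP_pow L (fun _ : Fin d => N n * M) (k + 1)) (bpos b)) = UT.toSite (fun _ : Fin d => N n * M) y)
              (fun b => UT.ofSite (fun _ : Fin d => N n * M) (blockCoord (L ^ (k + 1)) (fun _ : Fin d => N n * M)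
                (siteCast (towerP_eq_fineP_pow L (fun _ : Fin d => N n * M) (k + 1)) (bpos b))))
            dHn := T
            blkn := fun n X =>
              ((Finset.univ.filter fun p : TPt d (N n * M) => tcubeOf (N n) M p ∈ X.1).image fun p : TPt d (N n * M) =>
                UT.ofSite (fun _ : Fin d => N n * M) (fun i => (⟨(p i).val, ZMod.val_lt (p i)⟩ : Fin (N n * M))) :
                  Finset (UT (fun _ : Fin d => N n * M)))
            ιn := fun n X A b =>
              if tcubeOf (N n) M (fun i => ((blockCoord (L ^ (k + 1)) (fun _ : Fin d => N n * M)
                  (siteCast (towerP_eq_fineP_pow L (fun _ : Fin d => N n * M) (k + 1)) (bpos b)) i : ℕ) : ZMod (N n * M))) ∈ X.1 then A b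
              else 0
            un := fun n x => Pi.single ((fun i => (⟨(x i).val, ZMod.val_lt (x i)⟩ : Fin (N n * M))), μ₀) w₀
            h190 := fun n _ => hT n
            hdist := hdist_torusGeom (fun n (_ : Fin d) => N n * M) η₀ L₀ M₀ R H
            hrow := hrow_torusGeom (fun n (_ : Fin d) => N n * M) η₀ L₀ M₀ R H hδr hσ₀ hcR
            hκB := fun _ => hκB
            hdom := fun n => ?_
            hm := fun n x y' => (supNorm_single_le _ _ w₀).trans hm
            hD := fun n => ?_ }, fun _ _ _ => rfl⟩
  · -- `hdom`: a fine bond above `X̄` lies in the box of the unit-lattice site below it, and that site meets `X̄`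
    intro X A t ht hloc
    refine (pi_norm_le_iff_of_nonneg ht).mpr fun b => ?_
    dsimp only
    by_cases hb : tcubeOf (N n) M (fun i => ((blockCoord (L ^ (k + 1)) (fun _ : Fin d => N n * M)
        (siteCast (towerP_eq_fineP_pow L (fun _ : Fin d => N n * M) (k + 1)) (bpos b)) i : ℕ) : ZMod (N n * M))) ∈ X.1
    · rw [if_pos hb]
      have hy : UT.ofSite (fun _ : Fin d => N n * M) (blockCoord (L ^ (k + 1)) (fun _ : Fin d => N n * M)
          (siteCast (towerP_eq_fineP_pow L (fun _ : Fin d => N n * M) (k + 1)) (bpos b))) ∈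
          ((Finset.univ.filter fun p : TPt d (N n * M) => tcubeOf (N n) M p ∈ X.1).image fun p : TPt d (N n * M) =>
            UT.ofSite (fun _ : Fin d => N n * M) (fun i => (⟨(p i).val, ZMod.val_lt (p i)⟩ : Fin (N n * M))) :
              Finset (UT (fun _ : Fin d => N n * M))) := by
        refine Finset.mem_image.mpr ⟨_, Finset.mem_filter.mpr ⟨Finset.mem_univ _, hb⟩, ?_⟩
        rw [finOfVal_natCast]
      refine (norm_apply_le_loc (g := toB6 (torusGeom (fun _ : Fin d => N n * M) (η₀ n) (L₀ n) (M₀ n)) (R n) (H n))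
        (box := fun y => Finset.univ.filter fun b : Bond d (towerP L (fun _ : Fin d => N n * M) (k + 1)) =>
          blockCoord (L ^ (k + 1)) (fun _ : Fin d => N n * M)
            (siteCast (towerP_eq_fineP_pow L (fun _ : Fin d => N n * M) (k + 1)) (bpos b)) = UT.toSite (fun _ : Fin d => N n * M) y)
        (blk := fun b => UT.ofSite (fun _ : Fin d => N n * M) (blockCoord (L ^ (k + 1)) (fun _ : Fin d => N n * M)
          (siteCast (towerP_eq_fineP_pow L (fun _ : Fin d => N n * M) (k + 1)) (bpos b))))
        (Finset.mem_filter.mpr ⟨Finset.mem_univ _, rfl⟩) A).trans (hloc i₀ _ hy)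
    · rw [if_neg hb, norm_zero]; exact ht
  · -- `hD`: the source `δ_{(ê x, μ₀)}·w₀` has size only at the block `ê x`; the unit-lattice sites of the cubes of `X̄` are `≥ dist(x, X̄)` away from `x`
    letI : DecidableEq (toB6 (torusGeom (fun _ : Fin d => N n * M) (η₀ n) (L₀ n) (M₀ n)) (R n) (H n)).Site :=
      inferInstanceAs (DecidableEq (UT (fun _ : Fin d => N n * M)))
    intro X x y hy y' hne
    obtain ⟨p, hp, rfl⟩ := Finset.mem_image.mp hy
    have hpX : tcubeOf (N n) M p ∈ X.1 := (Finset.mem_filter.mp hp).2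
    have hy' : UT.toSite (fun _ : Fin d => N n * M) y' = fun i => (⟨(x i).val, ZMod.val_lt (x i)⟩ : Fin (N n * M)) :=
      ((Finset.mem_filter.mp (mem_of_supNorm_single_ne_zero hne)).2).symm
    have hdist : (toB6 (torusGeom (fun _ : Fin d => N n * M) (η₀ n) (L₀ n) (M₀ n)) (R n) (H n)).dist
        (UT.ofSite (fun _ : Fin d => N n * M) (fun i => (⟨(p i).val, ZMod.val_lt (p i)⟩ : Fin (N n * M)))) y' = pl1 (p - x) := by
      show tdist1 (fun _ : Fin d => N n * M) (fun i => (⟨(p i).val, ZMod.val_lt (p i)⟩ : Fin (N n * M))) (UT.toSite _ y') = _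
      rw [hy']
      exact tdist1_finOfVal_eq_pl1 p x
    rw [hdist, pl1_sub_comm]
    calc q.θ * (geomT d (N n) M).distD x X ≤ 1 * (geomT d (N n) M).distD x X :=
          mul_le_mul_of_nonneg_right hθ1 ((geomT d (N n) M).distD_nonneg x X)
      _ ≤ pl1 (x - p) := by rw [one_mul]; exact distD_geomT_le_pl1_of_mem x p X hpX

end Socket

section Flat190

variable {d : ℕ} (hd : 1 ≤ d) (L : ℕ) [NeZero L] (hL : 1 ≤ L) (hL3 : 3 ≤ L)
  {𝔸 : Type*} [CStarAlgebra 𝔸] [Nontrivial 𝔸]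
  {W : Type} [NormedAddCommGroup W] [InnerProductSpace ℂ W] [FiniteDimensional ℂ W] (φ : W ≃ₗ[ℂ] 𝔸)
  {Mφ Mφ' : ℝ} (hMφ : 0 ≤ Mφ) (hMφ' : 0 ≤ Mφ') (hφ : ∀ w, ‖φ w‖ ≤ Mφ * ‖w‖) (hφ' : ∀ X, ‖φ.symm X‖ ≤ Mφ' * ‖X‖)
  {a : ℝ} (ha : 0 < a) {a' : ℝ} (ha' : 0 < a')
  (τ : 𝔸 →ₗ[ℂ] ℂ) {Cτ : ℝ} (hτ : ∀ X, ‖τ X‖ ≤ Cτ * ‖X‖) (hCτ : 0 ≤ Cτ) {Mτ : ℝ} (hτm : ∀ X Y : 𝔸, ‖τ (X * Y)‖ ≤ Mτ * ‖X‖ * ‖Y‖) (hMτ : 0 ≤ Mτ)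
  {ρw : ℝ} (hρw : 0 ≤ ρw)
  (hτ₁ : ∀ X : 𝔸, τ (star X) = conj (τ X)) (hτ₂ : ∀ X Y : 𝔸, τ (X * Y) = τ (Y * X)) (hφτ : ∀ X Y : 𝔸, ⟪φ.symm X, φ.symm Y⟫_ℂ = τ (star X * Y))
  (AQ : ℝ) (hAQ16 : 16 * ((d : ℝ) + 1) * ((d : ℝ) + 4) * c2' d L ≤ AQ)

include hd hL hL3 hMφ hMφ' hφ hφ' ha ha' hτ hCτ hτm hMτ hρw hτ₁ hτ₂ hφτ hAQ16 in
/-- **THE (190)-SOCKET OF ROW (D4) INHABITED AT ZERO BACKGROUND WITH `(δ∕δB)𝓗(0) := H₁,k(1)`, NO ANALYTIC LETTER** (memo `FLAT-LETTERS-LOCATED.md` §9 R7):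
`∃ (δ⋆, C⋆)` FIRST (§1); then for every height `k` on the diagonal `ηL^{k+1} = 1` with weights `c₀(L^{k+1})^d = c₁`, `|η|^d∕c₀ ≤ ρ_w`, every cube side `M`,
volume sequence `N`, size index set `I ∋ i₀`, block-torus geometry weights, source direction `μ₀` and value `w₀`, and every `q : Consts190` under NUMERICS ONLY
(`0 < q.σ`, `δr > 0` with `c₀(δr, q.σ∕δr)^d ≤ q.cR` ([3] (2.61)), `1 ≤ q.κB`, `q.δ15 ≤ δ⋆`, `C⋆ ≤ q.Cst`, `‖w₀‖ ≤ q.m`, `q.θ ≤ 1`):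
`∃ D : Data190 d M N (fun n => Bond d (towerP L (N n·M)^d (k+1)) → W) q` as in `exists_data190_tower_of_ineq190` with
`dHn n := (H₁,k(1))ᵉ↾ℝ` ([15] (129) ∕ [5] (3.126) ∕ [3] (1.103) at `U = 1`, at the display ∕ witness DERIVED in §1 and chosen per volume by `choose`),
WITH THE (4.35) COMPUTATION RULE EXPOSED for EVERY admissible display `(αU′, hα1′, hαL′, hU1′, hreg′)` and witness `hpos′` the consumer may hold («Y12c»
`H1k_display_irrel`): `D.hn n X̄ x = (b ↦ [unit-lattice site below b ∈ a cube of X̄] ? (H₁,k(1))ᵉ(δ_{(ê x, μ₀)}·w₀)(b) : 0)`.  Nothing of Bałaban's beyond NE9's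
flat tower operator is constructed; NOT his instance in a background field. [cite: Balaban1987RG1, (4.4) p.281, p.282, (4.35) p.290]
[cite: Balaban1985Variational, (129)–(130) p.297, (182) p.307, (190) p.308] [cite: Balaban1985BackgroundPropagators, (3.126) p.420, (3.133) p.422, (3.134) p.422,
Thm 3.11 p.416] [cite: Balaban1984PropagatorsII, (1.103) p.36, (2.46) p.231, (2.51)–(2.52) p.232, Lemma 2.1 (2.61) p.234] -/
theorem exists_data190_tower_flat :
    ∃ δs Cs : ℝ, 0 < δs ∧ 0 ≤ Cs ∧
      ∀ (k : ℕ) (η : ℝ) (_hηL : η * (L : ℝ) ^ (k + 1) = 1) (c₀ c₁ : ℝ) [Fact (0 < c₀)] [Fact (0 < c₁)]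
        (_hw : c₀ * ((L : ℝ) ^ (k + 1)) ^ d = c₁) (_hρ : |η| ^ d / c₀ ≤ ρw)
        (M : ℕ) [NeZero M] (N : ℕ → ℕ) [∀ n, NeZero (N n)] (I : Type) (_i₀ : I) (η₀ L₀ M₀ R : ℕ → ℝ) (H : ℕ → Prop)
        (μ₀ : Fin d) (w₀ : W) (q : Consts190) (δr : ℝ)
        (_hδr : 0 < δr) (_hσ₀ : 0 < q.σ) (_hcR : B6.c0 δr (q.σ / δr) ^ d ≤ q.cR) (_hκB : 1 ≤ q.κB)
        (_hδ15 : q.δ15 ≤ δs) (_hCst : Cs ≤ q.Cst) (_hm : ‖w₀‖ ≤ q.m) (_hθ1 : q.θ ≤ 1),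
      ∃ D : Data190 d M N (fun n => Bond d (towerP L (fun _ : Fin d => N n * M) (k + 1)) → W) q,
        ∀ (n : ℕ) (X : TDom d (N n)) (x : TPt d (N n * M))
          -- ANY admissible regularity display, onto-threshold and positivity witness of `Δ_{a,k}(1)` the consumer holds:
          (αU' : ℕ → ℝ) (hα1' : ∀ j, αU' j ≤ 1 / 64) (hαL' : ∀ j, 50 * (d + 1) * αU' j * (L : ℝ) ^ d ≤ 1 / 2)
          (hU1' : ∀ (j : ℕ) (z : B7Prop1Explicit.Site d) (κ : Fin d),
            perCfg (towerP L (fun _ : Fin d => N n * M) (j + 1)) (UlevOf L (fun _ : Fin d => N n * M) (k + 1) (fun _ => (1 : 𝔸ˣ)) j) z κ ∈ U1 𝔸)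
          (hreg' : ∀ (j : ℕ) (y : TSite d (towerP L (fun _ : Fin d => N n * M) j)) (κ : Fin d) (ρ' : Fin d → Fin L),
            ‖((Wcx L (perCfg (towerP L (fun _ : Fin d => N n * M) (j + 1)) (UlevOf L (fun _ : Fin d => N n * M) (k + 1) (fun _ => (1 : 𝔸ˣ)) j))
                (cornerSite L y) κ (boxVec L ρ') : 𝔸ˣ) : 𝔸) - 1‖ ≤ αU' j)
          (hpos' : ∀ v : BondL2K ℂ d (towerP L (fun _ : Fin d => N n * M) (k + 1)) c₀ W, v ≠ 0 →
            0 < RCLike.re ⟪v, laplaceAk L (fun _ : Fin d => N n * M) k φ η (fun _ => (1 : 𝔸ˣ)) hL αU' hα1' hU1' hreg' τ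
              (c₀ := c₀) (c₁ := c₁) a v⟫_ℂ),
          D.hn n X x = fun b : Bond d (towerP L (fun _ : Fin d => N n * M) (k + 1)) =>
            if tcubeOf (N n) M (fun i => ((blockCoord (L ^ (k + 1)) (fun _ : Fin d => N n * M)
                  (siteCast (towerP_eq_fineP_pow L (fun _ : Fin d => N n * M) (k + 1)) (bpos b)) i : ℕ) : ZMod (N n * M))) ∈ X.1 then
              ((WL2.linearEquiv ℂ ℂ (fun _ : Bond d (towerP L (fun _ : Fin d => N n * M) (k + 1)) => c₀) :
                  BondL2K ℂ d (towerP L (fun _ : Fin d => N n * M) (k + 1)) c₀ W ≃ₗ[ℂ]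
                    (Bond d (towerP L (fun _ : Fin d => N n * M) (k + 1)) → W))
                (H1k L (fun _ : Fin d => N n * M) k φ η (fun _ => (1 : 𝔸ˣ)) hL αU' hα1' hU1' hreg' τ (c₀ := c₀) (c₁ := c₁) hαL' hpos'
                  ((WL2.linearEquiv ℂ ℂ (fun _ : Bond d (fun _ : Fin d => N n * M) => c₁) :
                      BondL2K ℂ d (fun _ : Fin d => N n * M) c₁ W ≃ₗ[ℂ] (Bond d (fun _ : Fin d => N n * M) → W)).symm
                    (Pi.single ((fun i => (⟨(x i).val, ZMod.val_lt (x i)⟩ : Fin (N n * M))), μ₀) w₀)))) b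
            else 0 := by
  obtain ⟨δs, Cs, hδs, hCs, HY⟩ :=
    exists_ineq190_H1k_flat hd L hL hL3 φ hMφ hMφ' hφ hφ' ha ha' τ hτ hCτ hτm hMτ hρw hτ₁ hτ₂ hφτ AQ hAQ16
  refine ⟨δs, Cs, hδs, hCs, ?_⟩
  intro k η hηL c₀ c₁ _ _ hw hρ M _ N _ I i₀ η₀ L₀ M₀ R H μ₀ w₀ q δr hδr hσ₀ hcR hκB hδ15 hCst hm hθ1
  have hmN : ∀ n, ∀ i : Fin d, 1 ≤ (fun _ : Fin d => N n * M) i := fun n _ => Nat.pos_of_neZero _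
  -- §1 per volume: an admissible display ∕ witness of `Δ_{a,k}(1)` and the (190) letter of `H₁,k(1)`, chosen once for every `n`
  have HYn := fun n => HY k η hηL c₀ c₁ hw hρ (fun _ : Fin d => N n * M) (hmN n) (η₀ n) (L₀ n) (M₀ n) (R n) (H n) q.Cst q.δ15 hδ15 hCst
  choose αU hα1 hαL hU1 hreg hpos h190 using HYn
  obtain ⟨D, hD⟩ := exists_data190_tower_of_ineq190 L k M N I i₀ η₀ L₀ M₀ R H μ₀ w₀ q
    (fun n => ((WL2.linearEquiv ℂ ℂ (fun _ : Bond d (towerP L (fun _ : Fin d => N n * M) (k + 1)) => c₀) :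
          BondL2K ℂ d (towerP L (fun _ : Fin d => N n * M) (k + 1)) c₀ W ≃ₗ[ℂ]
            (Bond d (towerP L (fun _ : Fin d => N n * M) (k + 1)) → W)).toLinearMap ∘ₗ
      H1k L (fun _ : Fin d => N n * M) k φ η (fun _ => (1 : 𝔸ˣ)) hL (αU n) (hα1 n) (hU1 n) (hreg n) τ (c₀ := c₀) (c₁ := c₁)
        (hαL n) (hpos n) ∘ₗ
      (WL2.linearEquiv ℂ ℂ (fun _ : Bond d (fun _ : Fin d => N n * M) => c₁) :
          BondL2K ℂ d (fun _ : Fin d => N n * M) c₁ W ≃ₗ[ℂ] (Bond d (fun _ : Fin d => N n * M) → W)).symm.toLinearMap).restrictScalars ℝ)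
    h190 hδr hσ₀ hcR hκB hm hθ1
  refine ⟨D, fun n X x αU' hα1' hαL' hU1' hreg' hpos' => ?_⟩
  -- the (4.35) computation rule, at ANY admissible display ∕ witness («Y12c»)
  rw [hD, ← H1k_display_irrel L (fun _ : Fin d => N n * M) k φ η (fun _ => (1 : 𝔸ˣ)) hL (αU n) αU' (hα1 n) hα1' (hU1 n) hU1' (hreg n) hreg'
    τ (hαL n) hαL' (hpos n) hpos']
  rfl

end Flat190

end Literature.MathematicalPhysics.QuantumFieldTheory.Balaban1983to89.Beta.RemainderData190TowerFlat

end
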